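/-
Copyright (c) 2026 the pub-hodgecm-mathlib formalisation cell (harness21).  Prover seat hodgecm-mathlib-LA5-p02 (g2); L8-PREP road B,
organ B3 «EXTEND» (LA7-plan (g2) deal 2026-09-02T04:10:09Z).  KERNEL: theorems only, Mathlib only.
-/
import Mathlib.Geometry.Manifold.MFDeriv.Atlas
import Mathlib.Geometry.Manifold.MFDeriv.SpecificFunctions
import Mathlib.Geometry.Manifold.ContMDiff.Constructions
import Mathlib.Geometry.Manifold.ContMDiff.NormedSpace
import Mathlib.Analysis.SpecificLimits.Basic
import HarnessLib

/-!
# Extension of a linearising chart along an étale self-map: the global equivariant map `ex (u, z) = φ^[k] (Θ⁻¹ (u, c^{-k} z))`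
# ([Milnor2006] §8 (Koenigs linearisation), Cor. 8.4; [Sternberg1957] Thm. 1; [Tate1967] §2.3)

Layer `Literature/Geometry/ComplexAnalytic`, namespace `Literature.Geometry.ComplexAnalytic.DoublingChartExtension`.  THEOREMS ONLY (no
definition, no named fact, no instance, no notation, no `sorry`), Mathlib only.  Cell `hodgecm-mathlib`, L8-PREP (HOME-only prep for the
E-line's printed residue P-1 `relativeExponentialUniformisation`), road B organ B3 «EXTEND» of LA7-plan (g2)'s skeleton `StubFLOW.roadB`
(`RoadB.EXTEND` :217): the purely differential-topological step of the «doubling-iteration logarithm» construction of the relative exponential.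

SETTING.  `𝕜` a nontrivially normed field, `c : 𝕜` with `1 < ‖c‖` (road B: `𝕜 = ℂ`, `c = 2`); analytic (`C^ω`) manifolds `MA` (model `EA`) and
`MS` (model `ES`), a normed `𝕜`-space `F` (the fibre coordinates); ANY map `p : MA → MS` («base point»; only the algebraic identities
`p ∘ two = p`, `(Θ a).1 = p a` are used, never its regularity); a `C^ω` self-map `two : MA → MA` over `p` with bijective differential
everywhere (étale), a continuous «zero section» `zero : MS → MA` fixed by `two`, and a LINEARISING CHART `Θ : MA ⇀ MS × F` at `zero m`: bi-`C^ω`,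
first coordinate `p`, `Θ (zero u) = (u, 0)`, conjugating `two` to the dilation `(u, w) ↦ (u, c • w)`.

RESULT **`exists_equivariant_extension`**: an open `U ∋ m`, `ρ > 0` and `ex : MS × F → MA`, `C^ω` on `U × F`, over `p`, `ex (u, 0) = zero u`,
`two (ex (u, z)) = ex (u, c • z)`, with bijective differential on `U × F`, `U × ball 0 ρ ⊆ Θ.target` and `ex = Θ.symm` on `U × ball 0 ρ`.
CONSTRUCTION: `ex (u, z) := two^[k] (Θ.symm (u, (c ^ k)⁻¹ • z))` for any `k` with `‖z‖ < ρ ‖c‖^k`; `k`-independence from the iterated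
conjugacy `two^[k] (Θ.symm (u, w)) = Θ.symm (u, c ^ k • w)` (`‖c ^ k • w‖ < ρ`), where `U`, `ρ` are chosen by continuity so that
`U × ball 0 ρ ⊆ Θ.target`, `two (Θ.symm (U × ball 0 ρ)) ⊆ Θ.source` and `zero U ⊆ Θ.source`; regularity and the differential LOCALLY,
with `k` frozen on the open piece `{‖z‖ < ρ ‖c‖^k}`, as the composite of `two^[k]`, `Θ.symm` and the product automorphism
`(u, w) ↦ (u, (c ^ k)⁻¹ • w)` (Mathlib `ContMDiffOn.comp`, `mfderiv_comp`, `OpenPartialHomeomorph.MDifferentiable.mfderiv_bijective`).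

* §1 iterates of an étale `C^ω` map (`contMDiff_iterate`, `mfderiv_iterate_bijective`, `apply_iterate_eq`); the scaling automorphism of
  `MS × F` (`contMDiff_prodScale`, `mfderiv_prodScale_bijective`).
* §2 **`exists_equivariant_extension`**.

HC_CM is proved only modulo the 7 printed citations until rung 0 closes; nothing here bears on a summit statement (count-neutral capital).

## References
* [Milnor2006] J. Milnor, *Dynamics in One Complex Variable*, 3rd ed. (2006), §8 Thm. 8.2 (Koenigs linearisation), Cor. 8.4 (global
  extension of the linearising coordinate by `φ ∘ f^{∘n} ∕ λ^n`).
* [Sternberg1957] S. Sternberg, *Local contractions and a theorem of Poincaré*, Amer. J. Math. 79 (1957), Thm. 1 (linearisation of an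
  expanding∕contracting germ).
* [Tate1967] J. Tate, *p-divisible groups* (1967), §2.3 (the logarithm by iteration of `[p]`).
-/

set_option autoImplicit false

open scoped Manifold ContDiff Topology
open Set Function Filter

noncomputable section

namespace Literature.Geometry.ComplexAnalytic.DoublingChartExtension

variable {𝕜 : Type*} [NontriviallyNormedField 𝕜]
  {EA : Type*} [NormedAddCommGroup EA] [NormedSpace 𝕜 EA]
  {ES : Type*} [NormedAddCommGroup ES] [NormedSpace 𝕜 ES]
  {F : Type*} [NormedAddCommGroup F] [NormedSpace 𝕜 F]
  {MA : Type*} [TopologicalSpace MA] [ChartedSpace EA MA]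
  {MS : Type*} [TopologicalSpace MS] [ChartedSpace ES MS]

/-! ## §1 Iterates of an étale `C^ω` map; the scaling automorphism of `MS × F` -/

/-- Iterates of a `C^n` self-map are `C^n`. [cite: Milnor2006, §8 Cor. 8.4] -/
theorem contMDiff_iterate {n : WithTop ℕ∞} {two : MA → MA} (htwo : ContMDiff 𝓘(𝕜, EA) 𝓘(𝕜, EA) n two) (k : ℕ) :
    ContMDiff 𝓘(𝕜, EA) 𝓘(𝕜, EA) n two^[k] := by
  induction k with
  | zero => exact contMDiff_id
  | succ k ih => rw [Function.iterate_succ]; exact ih.comp htwo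

/-- The differential of an iterate of an étale differentiable self-map is bijective everywhere. [cite: Milnor2006, §8 Cor. 8.4] -/
theorem mfderiv_iterate_bijective {two : MA → MA} (hdiff : MDifferentiable 𝓘(𝕜, EA) 𝓘(𝕜, EA) two)
    (hbij : ∀ a, Bijective (mfderiv 𝓘(𝕜, EA) 𝓘(𝕜, EA) two a)) (k : ℕ) (a : MA) :
    Bijective (mfderiv 𝓘(𝕜, EA) 𝓘(𝕜, EA) two^[k] a) := by
  induction k generalizing a with
  | zero =>
      rw [Function.iterate_zero, mfderiv_id]
      exact bijective_id
  | succ k ih =>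
      have hdk : MDifferentiable 𝓘(𝕜, EA) 𝓘(𝕜, EA) two^[k] := by
        clear ih
        induction k with
        | zero => exact mdifferentiable_id
        | succ k ih' => rw [Function.iterate_succ]; exact ih'.comp hdiff
      rw [Function.iterate_succ, mfderiv_comp a (hdk (two a)) (hdiff a)]
      exact (ih (two a)).comp (hbij a)

/-- An invariant of `two` is an invariant of its iterates: `p (two^[k] a) = p a`. [cite: Milnor2006, §8 Cor. 8.4] -/
theorem apply_iterate_eq {X Y : Type*} {two : X → X} {p : X → Y} (hp : ∀ a, p (two a) = p a) (k : ℕ) (a : X) : p (two^[k] a) = p a := by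
  induction k with
  | zero => rfl
  | succ k ih => rw [Function.iterate_succ_apply', hp, ih]

/-- The scaling `(u, w) ↦ (u, a • w)` of `MS × F` is `C^n` for the product model. [cite: Sternberg1957, Thm. 1] -/
theorem contMDiff_prodScale {n : WithTop ℕ∞} (a : 𝕜) :
    ContMDiff (𝓘(𝕜, ES).prod 𝓘(𝕜, F)) (𝓘(𝕜, ES).prod 𝓘(𝕜, F)) n (fun q : MS × F => (q.1, a • q.2)) := by
  have h : ContMDiff 𝓘(𝕜, F) 𝓘(𝕜, F) n (fun w : F => a • w) := contMDiff_iff_contDiff.mpr (contDiff_const_smul a)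
  exact contMDiff_id.prodMap h

/-- The differential of the scaling `(u, w) ↦ (u, a • w)`, `a ≠ 0`, is bijective everywhere (it is a bi-`C^ω` homeomorphism of `MS × F`).
[cite: Sternberg1957, Thm. 1] -/
theorem mfderiv_prodScale_bijective {a : 𝕜} (ha : a ≠ 0) (q : MS × F) :
    Bijective (mfderiv (𝓘(𝕜, ES).prod 𝓘(𝕜, F)) (𝓘(𝕜, ES).prod 𝓘(𝕜, F)) (fun q : MS × F => (q.1, a • q.2)) q) := by
  let σ : OpenPartialHomeomorph (MS × F) (MS × F) :=
    ((Homeomorph.refl MS).prodCongr (Homeomorph.smulOfNeZero a ha)).toOpenPartialHomeomorph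
  have hσ : (σ : MS × F → MS × F) = fun q : MS × F => (q.1, a • q.2) := by
    ext q <;> rfl
  have hσ' : (σ.symm : MS × F → MS × F) = fun q : MS × F => (q.1, a⁻¹ • q.2) := by
    ext q <;> rfl
  have hmd : σ.MDifferentiable (𝓘(𝕜, ES).prod 𝓘(𝕜, F)) (𝓘(𝕜, ES).prod 𝓘(𝕜, F)) := by
    refine ⟨?_, ?_⟩
    · rw [hσ]
      exact ((contMDiff_prodScale (n := ω) a).mdifferentiable (by simp)).mdifferentiableOn
    · rw [hσ']
      exact ((contMDiff_prodScale (n := ω) a⁻¹).mdifferentiable (by simp)).mdifferentiableOn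
  have := hmd.mfderiv_bijective (x := q) (by simp [σ])
  rwa [hσ] at this

/-! ## §2 The extension -/

/-- **EXTENSION OF A LINEARISING CHART ALONG AN ÉTALE SELF-MAP** (road B organ B3 «EXTEND» with an arbitrary base map `p`).  Given a `C^ω`
étale self-map `two` of `MA` over `p : MA → MS` fixing the continuous section `zero`, and a bi-`C^ω` chart `Θ : MA ⇀ MS × F` at `zero m` with
first coordinate `p`, `Θ (zero u) = (u, 0)` and `Θ ∘ two = (id × (c • ·)) ∘ Θ` (`1 < ‖c‖`): there are an open `U ∋ m`, `ρ > 0` and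
`ex : MS × F → MA`, `C^ω` on `U × F`, over `p`, `ex (u, 0) = zero u`, `two (ex (u, z)) = ex (u, c • z)`, with bijective differential on
`U × F`, `U × ball 0 ρ ⊆ Θ.target`, `ex = Θ.symm` on `U × ball 0 ρ` — namely `ex (u, z) = two^[k] (Θ.symm (u, (c ^ k)⁻¹ • z))` for
`‖z‖ < ρ ‖c‖ ^ k`. [cite: Milnor2006, §8 Thm. 8.2, Cor. 8.4] [cite: Sternberg1957, Thm. 1] [cite: Tate1967, §2.3] -/
theorem exists_equivariant_extension [IsManifold 𝓘(𝕜, EA) ω MA] [IsManifold 𝓘(𝕜, ES) ω MS]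
    (p : MA → MS) (two : MA → MA) (zero : MS → MA) (Θ : OpenPartialHomeomorph MA (MS × F)) (m : MS) {c : 𝕜} (hc : 1 < ‖c‖)
    (htwo : ContMDiff 𝓘(𝕜, EA) 𝓘(𝕜, EA) ω two)
    (htwo' : ∀ a : MA, Bijective (mfderiv 𝓘(𝕜, EA) 𝓘(𝕜, EA) two a))
    (hp_two : ∀ a : MA, p (two a) = p a)
    (hzero : Continuous zero)
    (htwo_zero : ∀ u : MS, two (zero u) = zero u)
    (hm : zero m ∈ Θ.source)
    (hΘ : ContMDiffOn 𝓘(𝕜, EA) (𝓘(𝕜, ES).prod 𝓘(𝕜, F)) ω Θ Θ.source)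
    (hΘsymm : ContMDiffOn (𝓘(𝕜, ES).prod 𝓘(𝕜, F)) 𝓘(𝕜, EA) ω Θ.symm Θ.target)
    (hΘfst : ∀ a ∈ Θ.source, (Θ a).1 = p a)
    (hΘzero : ∀ u : MS, zero u ∈ Θ.source → Θ (zero u) = (u, 0))
    (hΘtwo : ∀ a ∈ Θ.source, two a ∈ Θ.source → Θ (two a) = ((Θ a).1, c • (Θ a).2)) :
    ∃ (U : Set MS) (ex : MS × F → MA) (ρ : ℝ), IsOpen U ∧ m ∈ U ∧ 0 < ρ ∧
      ContMDiffOn (𝓘(𝕜, ES).prod 𝓘(𝕜, F)) 𝓘(𝕜, EA) ω ex (U ×ˢ univ) ∧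
      (∀ u ∈ U, ∀ z : F, p (ex (u, z)) = u) ∧
      (∀ u ∈ U, ex (u, 0) = zero u) ∧
      (∀ u ∈ U, ∀ z : F, two (ex (u, z)) = ex (u, c • z)) ∧
      (∀ q ∈ U ×ˢ (univ : Set F), Bijective (mfderiv (𝓘(𝕜, ES).prod 𝓘(𝕜, F)) 𝓘(𝕜, EA) ex q)) ∧
      U ×ˢ Metric.ball (0 : F) ρ ⊆ Θ.target ∧
      (∀ u ∈ U, ∀ z ∈ Metric.ball (0 : F) ρ, ex (u, z) = Θ.symm (u, z)) := by
  -- scalar facts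
  have hc0 : c ≠ 0 := norm_pos_iff.mp (one_pos.trans hc)
  have hc1 : 1 ≤ ‖c‖ := hc.le
  have hcpow : ∀ k : ℕ, 1 ≤ ‖c‖ ^ k := fun k => one_le_pow₀ hc1
  -- `(m, 0) ∈ Θ.target`, `Θ.symm (m, 0) = zero m`
  have hm0 : Θ (zero m) = (m, 0) := hΘzero m hm
  have hmt : ((m, (0 : F)) : MS × F) ∈ Θ.target := by rw [← hm0]; exact Θ.map_source hm
  have hms : Θ.symm (m, 0) = zero m := by rw [← hm0, Θ.left_inv hm]
  -- the open set `T₀ := Θ.target ∩ Θ.symm ⁻¹' (two ⁻¹' Θ.source)` contains `(m, 0)`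
  have hT₀ : IsOpen (Θ.target ∩ Θ.symm ⁻¹' (two ⁻¹' Θ.source)) :=
    Θ.isOpen_inter_preimage_symm (Θ.open_source.preimage htwo.continuous)
  have hmT₀ : ((m, (0 : F)) : MS × F) ∈ Θ.target ∩ Θ.symm ⁻¹' (two ⁻¹' Θ.source) := by
    refine ⟨hmt, ?_⟩
    show two (Θ.symm (m, 0)) ∈ Θ.source
    rw [hms, htwo_zero]
    exact hm
  -- a product neighbourhood `U₁ × ball 0 ρ ⊆ T₀`
  obtain ⟨U₁, hU₁m, W, hW0, hUW⟩ := mem_nhds_prod_iff.mp (hT₀.mem_nhds hmT₀)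
  obtain ⟨ρ, hρ, hρW⟩ := Metric.mem_nhds_iff.mp hW0
  obtain ⟨U₂, hU₂U₁, hU₂open, hmU₂⟩ := mem_nhds_iff.mp hU₁m
  -- shrink so that `zero u ∈ Θ.source`
  set U : Set MS := U₂ ∩ zero ⁻¹' Θ.source with hUdef
  have hUopen : IsOpen U := hU₂open.inter (Θ.open_source.preimage hzero)
  have hmU : m ∈ U := ⟨hmU₂, hm⟩
  have hUT₀ : ∀ u ∈ U, ∀ w ∈ Metric.ball (0 : F) ρ, ((u, w) : MS × F) ∈ Θ.target ∧ two (Θ.symm (u, w)) ∈ Θ.source :=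
    fun u hu w hw => hUW (mk_mem_prod (hU₂U₁ hu.1) (hρW hw))
  -- norm bookkeeping
  have hnorm_le : ∀ (k : ℕ) (w : F), ‖w‖ ≤ ‖c ^ k • w‖ := fun k w => by
    rw [norm_smul, norm_pow]
    exact le_mul_of_one_le_left (norm_nonneg w) (hcpow k)
  -- (C) one conjugacy step
  have hC : ∀ u ∈ U, ∀ w : F, ‖c • w‖ < ρ → two (Θ.symm (u, w)) = Θ.symm (u, c • w) := by
    intro u hu w hw
    have hw' : w ∈ Metric.ball (0 : F) ρ := by
      rw [Metric.mem_ball, dist_zero_right]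
      exact (by simpa using hnorm_le 1 w : ‖w‖ ≤ ‖c • w‖).trans_lt hw
    obtain ⟨hqt, htwos⟩ := hUT₀ u hu w hw'
    have has : Θ.symm (u, w) ∈ Θ.source := Θ.map_target hqt
    have hΘa : Θ (Θ.symm (u, w)) = (u, w) := Θ.right_inv hqt
    have h := hΘtwo _ has htwos
    rw [hΘa] at h
    rw [← h, Θ.left_inv htwos]
  -- (Cᵏ) iterated conjugacy
  have hCk : ∀ (k : ℕ), ∀ u ∈ U, ∀ w : F, ‖c ^ k • w‖ < ρ → two^[k] (Θ.symm (u, w)) = Θ.symm (u, c ^ k • w) := by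
    intro k
    induction k with
    | zero => intro u hu w _; simp
    | succ k ih =>
        intro u hu w hw
        have h1 : ‖c • w‖ < ρ := by
          refine lt_of_le_of_lt ?_ hw
          rw [norm_smul, norm_smul, norm_pow]
          exact mul_le_mul_of_nonneg_right (le_self_pow₀ hc1 (Nat.succ_ne_zero k)) (norm_nonneg w)
        have h2 : ‖c ^ k • (c • w)‖ < ρ := by rwa [smul_smul, ← pow_succ]
        rw [Function.iterate_succ_apply, hC u hu w h1, ih u hu (c • w) h2, smul_smul, ← pow_succ]
  -- the frozen-`k` pieces `exAux k (u, z) := two^[k] (Θ.symm (u, (c ^ k)⁻¹ • z))`, good for `‖z‖ < ρ * ‖c‖ ^ k`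
  have hgood_iff : ∀ (k : ℕ) (z : F), ‖(c ^ k)⁻¹ • z‖ < ρ ↔ ‖z‖ < ρ * ‖c‖ ^ k := fun k z => by
    rw [norm_smul, norm_inv, norm_pow, inv_mul_lt_iff₀ (by positivity), mul_comm]
  have hgood_mono : ∀ {j k : ℕ} (z : F), j ≤ k → ‖z‖ < ρ * ‖c‖ ^ j → ‖z‖ < ρ * ‖c‖ ^ k := fun z hjk h =>
    h.trans_le (mul_le_mul_of_nonneg_left (pow_le_pow_right₀ hc1 hjk) hρ.le)
  -- `k`-independence
  have hindep : ∀ (j k : ℕ) (u : MS) (z : F), u ∈ U → ‖z‖ < ρ * ‖c‖ ^ j → ‖z‖ < ρ * ‖c‖ ^ k →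
      two^[j] (Θ.symm (u, (c ^ j)⁻¹ • z)) = two^[k] (Θ.symm (u, (c ^ k)⁻¹ • z)) := by
    suffices key : ∀ (j i : ℕ) (u : MS) (z : F), u ∈ U → ‖z‖ < ρ * ‖c‖ ^ j →
        two^[j + i] (Θ.symm (u, (c ^ (j + i))⁻¹ • z)) = two^[j] (Θ.symm (u, (c ^ j)⁻¹ • z)) by
      intro j k u z hu hj hk
      rcases le_total j k with hjk | hkj
      · obtain ⟨i, rfl⟩ := Nat.exists_eq_add_of_le hjk
        exact (key j i u z hu hj).symm
      · obtain ⟨i, rfl⟩ := Nat.exists_eq_add_of_le hkj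
        exact key k i u z hu hk
    intro j i u z hu hj
    have hscal : c ^ i • (c ^ (j + i))⁻¹ • z = (c ^ j)⁻¹ • z := by
      rw [smul_smul]
      congr 1
      rw [pow_add, mul_inv, ← mul_assoc, mul_comm (c ^ i), mul_assoc, mul_inv_cancel₀ (pow_ne_zero i hc0), mul_one]
    have hlt : ‖c ^ i • (c ^ (j + i))⁻¹ • z‖ < ρ := by rw [hscal, hgood_iff]; exact hj
    rw [Function.iterate_add_apply, hCk i u hu _ hlt, hscal]
  -- choose `k z`
  have hex : ∀ z : F, ∃ k : ℕ, ‖z‖ < ρ * ‖c‖ ^ k := fun z => by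
    obtain ⟨k, hk⟩ := pow_unbounded_of_one_lt (‖z‖ / ρ) hc
    exact ⟨k, (div_lt_iff₀' hρ).mp hk⟩
  choose K hK using hex
  -- THE MAP
  let ex : MS × F → MA := fun q => two^[K q.2] (Θ.symm (q.1, (c ^ K q.2)⁻¹ • q.2))
  have hex_eq : ∀ (k : ℕ) (u : MS) (z : F), u ∈ U → ‖z‖ < ρ * ‖c‖ ^ k → ex (u, z) = two^[k] (Θ.symm (u, (c ^ k)⁻¹ • z)) :=
    fun k u z hu hk => hindep _ _ u z hu (hK z) hk
  -- the frozen-`k` composite and its domain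
  have hpiece : ∀ k : ℕ, IsOpen {q : MS × F | ‖q.2‖ < ρ * ‖c‖ ^ k} := fun k =>
    isOpen_lt (continuous_norm.comp continuous_snd) continuous_const
  have hmaps : ∀ (k : ℕ), ∀ q ∈ (U ×ˢ (univ : Set F)) ∩ {q : MS × F | ‖q.2‖ < ρ * ‖c‖ ^ k},
      ((q.1, (c ^ k)⁻¹ • q.2) : MS × F) ∈ Θ.target := by
    rintro k ⟨u, z⟩ ⟨⟨hu, -⟩, hz⟩
    refine (hUT₀ u hu _ ?_).1
    rw [Metric.mem_ball, dist_zero_right, hgood_iff]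
    exact hz
  have hcomp_contMDiff : ∀ k : ℕ, ContMDiffOn (𝓘(𝕜, ES).prod 𝓘(𝕜, F)) 𝓘(𝕜, EA) ω
      (fun q : MS × F => two^[k] (Θ.symm (q.1, (c ^ k)⁻¹ • q.2))) ((U ×ˢ (univ : Set F)) ∩ {q : MS × F | ‖q.2‖ < ρ * ‖c‖ ^ k}) := by
    intro k
    have h1 : ContMDiffOn (𝓘(𝕜, ES).prod 𝓘(𝕜, F)) (𝓘(𝕜, ES).prod 𝓘(𝕜, F)) ω (fun q : MS × F => (q.1, (c ^ k)⁻¹ • q.2))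
        ((U ×ˢ (univ : Set F)) ∩ {q : MS × F | ‖q.2‖ < ρ * ‖c‖ ^ k}) := (contMDiff_prodScale _).contMDiffOn
    have h2 := hΘsymm.comp h1 (fun q hq => hmaps k q hq)
    exact (contMDiff_iterate htwo k).comp_contMDiffOn h2
  have hex_eqOn : ∀ k : ℕ, EqOn ex (fun q : MS × F => two^[k] (Θ.symm (q.1, (c ^ k)⁻¹ • q.2)))
      ((U ×ˢ (univ : Set F)) ∩ {q : MS × F | ‖q.2‖ < ρ * ‖c‖ ^ k}) := by
    intro k
    rintro ⟨u, z⟩ ⟨⟨hu, -⟩, hz⟩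
    exact hex_eq k u z hu hz
  refine ⟨U, ex, ρ, hUopen, hmU, hρ, ?_, ?_, ?_, ?_, ?_, ?_, ?_⟩
  · -- `C^ω` on `U × F`, locally
    refine contMDiffOn_of_locally_contMDiffOn fun q hq => ?_
    refine ⟨{q' : MS × F | ‖q'.2‖ < ρ * ‖c‖ ^ K q.2}, hpiece _, hK q.2, ?_⟩
    exact (hcomp_contMDiff (K q.2)).congr (hex_eqOn (K q.2))
  · -- over `p`
    intro u hu z
    show p (two^[K z] (Θ.symm (u, (c ^ K z)⁻¹ • z))) = u
    have hqt : ((u, (c ^ K z)⁻¹ • z) : MS × F) ∈ Θ.target := hmaps (K z) (u, z) ⟨⟨hu, mem_univ _⟩, hK z⟩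
    rw [apply_iterate_eq hp_two, ← hΘfst _ (Θ.map_target hqt), Θ.right_inv hqt]
  · -- normalisation
    intro u hu
    have h0 : ‖(0 : F)‖ < ρ * ‖c‖ ^ 0 := by simpa using hρ
    rw [hex_eq 0 u 0 hu h0, Function.iterate_zero, id, pow_zero, inv_one, one_smul, ← hΘzero u hu.2, Θ.left_inv hu.2]
  · -- equivariance
    intro u hu z
    have hk1 : ‖c • z‖ < ρ * ‖c‖ ^ (K z + 1) := by
      rw [norm_smul, pow_succ, ← mul_assoc, mul_comm (ρ * _)]
      exact mul_lt_mul_of_pos_left (hK z) (norm_pos_iff.mpr hc0)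
    rw [hex_eq (K z + 1) u (c • z) hu hk1, Function.iterate_succ_apply']
    show two (two^[K z] (Θ.symm (u, (c ^ K z)⁻¹ • z))) = _
    congr 3
    rw [smul_smul, pow_succ, mul_inv, mul_assoc, inv_mul_cancel₀ hc0, mul_one]
  · -- bijective differential, locally
    rintro q hq
    set k := K q.2 with hkdef
    have hV : (U ×ˢ (univ : Set F)) ∩ {q' : MS × F | ‖q'.2‖ < ρ * ‖c‖ ^ k} ∈ 𝓝 q :=
      ((hUopen.prod isOpen_univ).inter (hpiece k)).mem_nhds ⟨hq, hK q.2⟩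
    have heq : ex =ᶠ[𝓝 q] (fun q' : MS × F => two^[k] (Θ.symm (q'.1, (c ^ k)⁻¹ • q'.2))) :=
      Filter.eventuallyEq_of_mem hV (hex_eqOn k)
    rw [heq.mfderiv_eq]
    have hqt : ((q.1, (c ^ k)⁻¹ • q.2) : MS × F) ∈ Θ.target := hmaps k q ⟨hq, hK q.2⟩
    have hΘmd : Θ.MDifferentiable 𝓘(𝕜, EA) (𝓘(𝕜, ES).prod 𝓘(𝕜, F)) :=
      ⟨hΘ.mdifferentiableOn (by simp), hΘsymm.mdifferentiableOn (by simp)⟩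
    have hd1 : MDifferentiableAt (𝓘(𝕜, ES).prod 𝓘(𝕜, F)) (𝓘(𝕜, ES).prod 𝓘(𝕜, F)) (fun q' : MS × F => (q'.1, (c ^ k)⁻¹ • q'.2)) q :=
      ((contMDiff_prodScale (n := ω) _).mdifferentiable (by simp)) q
    have hd2 : MDifferentiableAt (𝓘(𝕜, ES).prod 𝓘(𝕜, F)) 𝓘(𝕜, EA) Θ.symm (q.1, (c ^ k)⁻¹ • q.2) :=
      hΘmd.mdifferentiableAt_symm hqt
    have hd3 : MDifferentiableAt 𝓘(𝕜, EA) 𝓘(𝕜, EA) two^[k] (Θ.symm (q.1, (c ^ k)⁻¹ • q.2)) :=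
      ((contMDiff_iterate htwo k).mdifferentiable (by simp)) _
    have hcomp1 : MDifferentiableAt (𝓘(𝕜, ES).prod 𝓘(𝕜, F)) 𝓘(𝕜, EA)
        (Θ.symm ∘ fun q' : MS × F => (q'.1, (c ^ k)⁻¹ • q'.2)) q := hd2.comp q hd1
    have e1 : (fun q' : MS × F => two^[k] (Θ.symm (q'.1, (c ^ k)⁻¹ • q'.2))) =
        two^[k] ∘ (Θ.symm ∘ fun q' : MS × F => (q'.1, (c ^ k)⁻¹ • q'.2)) := rfl
    rw [e1, mfderiv_comp q hd3 hcomp1, mfderiv_comp q hd2 hd1]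
    have hA := mfderiv_iterate_bijective (htwo.mdifferentiable (by simp)) htwo' k (Θ.symm (q.1, (c ^ k)⁻¹ • q.2))
    have hB := hΘmd.symm.mfderiv_bijective hqt
    have hC := mfderiv_prodScale_bijective (ES := ES) (MS := MS) (inv_ne_zero (pow_ne_zero k hc0)) q
    exact hA.comp (hB.comp hC)
  · -- `U × ball 0 ρ ⊆ Θ.target`
    rintro ⟨u, w⟩ ⟨hu, hw⟩
    exact (hUT₀ u hu w hw).1
  · -- `ex = Θ.symm` on `U × ball 0 ρ`
    intro u hu z hz
    have h0 : ‖z‖ < ρ * ‖c‖ ^ 0 := by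
      rw [pow_zero, mul_one]; rwa [Metric.mem_ball, dist_zero_right] at hz
    rw [hex_eq 0 u z hu h0, Function.iterate_zero, id, pow_zero, inv_one, one_smul]

end Literature.Geometry.ComplexAnalytic.DoublingChartExtension

end
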